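import Literature.MathematicalPhysics.KineticTheory.TaggedSphereHydrodynamicModeProfile
import Literature.MathematicalPhysics.KineticTheory.TaggedSphereModeEnergy
import Literature.MathematicalPhysics.KineticTheory.TaggedSphereGainSplit
import Literature.MathematicalPhysics.KineticTheory.TaggedSphereModeDuhamel
import HarnessLib

/-!
# BGSR (6.3): relaxation of the velocity profile of a Fourier mode, and the discharge of the
# hydrodynamic limit
(Bodineau–Gallagher–Saint-Raymond, Invent. Math. 203 (2016) = arXiv:1305.3397v2, §6.1, (6.3);
the closing layer of the bottom-up proof of the named fact
`Literature.MathematicalPhysics.KineticTheory.bgsr_hydrodynamicLimit` of `TaggedSphereDiffusion`)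

(6.3) has been reduced to trigonometric polynomials and to single Fourier modes
(`TaggedSphereHydrodynamicReduction`), and for a single mode to the *relaxation of its velocity
profile* `ĝ_n` (`TaggedSphereHydrodynamicModeProfile.bgsr_hydrodynamicLimit_mode_of_profile`):
`sup_{τ ≤ T} sup_v M_β(v) |ĝ_n(ατ, v) - e^{-4π² κ_β |n|² τ}| → 0` as `α → ∞`. This file PROVES that
relaxation and assembles `bgsr_hydrodynamicLimit_holds`.

1. **The rescaled profile solves the mode equation** (`isModePair_modeProfile`): with
   `G(τ, v) = ĝ_n(ατ, v) = P + iQ`, `∂_τ P = -α² a P + α ω Q + α² K⁺P`,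
   `∂_τ Q = -α² a Q - α ω P + α² K⁺Q` for `τ > 0` (the chain rule on
   `hasDerivAt_modeProfile`; `K⁺ = carlemanGain`), `|P|, |Q| ≤ 1`, `G(0) = 1` — the hypothesis
   bundle `IsModePair` of `TaggedSphereModeEnergy`, whose energy estimate therefore applies:
   `‖G(τ) - e^{-λτ}(1 - iα⁻¹ω_b)‖²_{L²(M_β)} ≤ C/α²` on `[0, T]`, `λ = 4π² κ_β |n|²`.
2. **Duhamel once more** (`modeProfile_duhamel`): from the pointwise ODE and continuity,
   `G(τ, v) = e^{-zτ} + α² ∫₀^τ e^{-z(τ-σ)} (K⁺G(σ))(v) dσ`, `z = α² a(v) + iαω(v)` (variation of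
   constants), hence with `h = G - e^{-λ·}` and `K⁺1 = a`:
   `G(τ, v) - e^{-λτ} = (e^{-λτ} - e^{-zτ})(λ - iαω)/(z - λ) + α² ∫₀^τ e^{-z(τ-σ)} (K⁺h(σ))(v) dσ`.
3. **Pointwise smallness** (`norm_modeProfile_sub_exp_le`): the explicit part is
   `≤ 4(λ + α|ω|)/(α² a) ≤ 4λ/(α² a₀) + 4 C_ω/α` (`TaggedSphereGainSplit`), and the gain part is
   `≤ a(v)⁻¹ sup_σ ‖K⁺h(σ)(v)‖ ≤ a₀⁻¹ (2Λ ‖h‖_{L¹(M)} + 4Λ^{-θ} M(v)^{-θ} C_θ)` by the split of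
   `TaggedSphereGainSplit` with the kernel moment of `TaggedSphereCarlemanMoment`, where
   `‖h(σ)‖_{L¹(M_β)} ≤ (α⁻¹ + α ‖h(σ)‖²_{L²(M_β)})/2 = O(α⁻¹)` by the energy estimate; with
   `Λ = √α` every term is `O(α^{-min(1/2, θ/2)})` uniformly in `v` and `τ ∈ [0, T]`.
4. **Assembly**: `modeProfile_relaxation` is exactly the hypothesis of
   `bgsr_hydrodynamicLimit_mode_of_profile`; with `bgsr_hydrodynamicLimit_of_mode` this gives
   `bgsr_hydrodynamicLimit_holds : bgsr_hydrodynamicLimit`, and the intermediate named facts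
   `bgsr_hydrodynamicLimit_mode_holds`, `bgsr_hydrodynamicLimit_trigPoly_holds`.

## References

* T. Bodineau, I. Gallagher, L. Saint-Raymond, *The Brownian motion as the limit of a
  deterministic system of hard-spheres*, Invent. Math. 203 (2016) 493–553 = arXiv:1305.3397v2,
  §6.1.1–6.1.3, (6.2)–(6.10).
* A. Bensoussan, J.-L. Lions, G. Papanicolaou, *Boundary layers and homogenization of transport
  processes*, Publ. RIMS 15 (1979) 53–157 (BGSR's [6]).
-/

open MeasureTheory Metric Set Filter Topology ProbabilityTheory
open scoped InnerProductSpace ENNReal NNReal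

namespace Literature.MathematicalPhysics.KineticTheory

noncomputable section

open Literature.Analysis.FunctionSpaces (maxwellianBeta maxwellianBeta_pos)
open TaggedSphereDiffusion (collisionFrequency)

variable {d : Type*} [Fintype d] {β : ℝ}

/-! ## Bridges between the mode data of the sibling files -/

/-- `ω_n` of `TaggedSphereHydrodynamicModeProfile` is `ω` of `TaggedSphereModeEnergy`. [folklore] -/
theorem modePhase_eq_modeFreq [DecidableEq d] (n : d → ℤ) (v : EuclideanSpace ℝ d) :
    modePhase n v = modeFreq n v := by
  rw [modePhase_eq_sum, modeFreq_eq_sum, Finset.mul_sum]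
  refine Finset.sum_congr rfl fun i _ => ?_
  ring

/-- `|n|² = ∑ nᵢ²` for the lattice vector. [folklore] -/
theorem norm_latticeVec_sq [DecidableEq d] (n : d → ℤ) :
    ‖(Literature.Analysis.FunctionSpaces.Torus.latticeVec n : EuclideanSpace ℝ d)‖ ^ 2 = ∑ i, (n i : ℝ) ^ 2 := by
  rw [EuclideanSpace.norm_sq_eq]
  refine Finset.sum_congr rfl fun i _ => ?_
  rw [Literature.Analysis.FunctionSpaces.Torus.latticeVec_apply, Real.norm_eq_abs, sq_abs]

/-- The heat exponent of the mode is the mode rate: `4π² κ_β |n|² τ = λ τ`. [folklore] -/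
theorem heatExponent_eq_modeRate [DecidableEq d] (β : ℝ) (b : EuclideanSpace ℝ d → EuclideanSpace ℝ d)
    (n : d → ℤ) (τ : ℝ) :
    4 * Real.pi ^ 2 * bgsrDiffusionCoeff β b *
        ‖(Literature.Analysis.FunctionSpaces.Torus.latticeVec n : EuclideanSpace ℝ d)‖ ^ 2 * τ =
      modeRate β b n * τ := by
  rw [norm_latticeVec_sq, modeRate]

/-- For a bounded measurable velocity function the gain of `TaggedLinearBoltzmannSeries` is the
Carleman gain. [folklore] -/
theorem linearBoltzmannGain_eq_carlemanGain_of_bounded (hd : 2 ≤ Fintype.card d) (hβ : 0 < β)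
    {g : EuclideanSpace ℝ d → ℝ} (hgm : Measurable g) {B : ℝ} (hB : ∀ w, |g w| ≤ B) (v : EuclideanSpace ℝ d) :
    linearBoltzmannGain β g v = carlemanGain β g v :=
  linearBoltzmannGain_eq_carlemanGain hd hβ hgm v (integrable_carlemanKernel_mul_of_bounded hd hβ hgm hB v)

/-! ## The rescaled profile solves the mode equation -/

/-- **The rescaled velocity profile is a solution of the mode equation** in the sense of
`IsModePair` (so that the energy estimate `IsModePair.modeEnergy_le` applies to it): with
`P(τ, v) = Re ĝ_n(ατ, v)`, `Q(τ, v) = Im ĝ_n(ατ, v)`.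
[cite: BodineauGallagherSaintRaymondInvent2016, (6.2)] -/
theorem isModePair_modeProfile [DecidableEq d] (hd : 2 ≤ Fintype.card d) (hβ : 0 < β) (n : d → ℤ)
    {α : ℝ} (hα : 0 < α) :
    IsModePair β α n (fun τ v => (modeProfile n β α (α * τ) v).re) (fun τ v => (modeProfile n β α (α * τ) v).im) := by
  have hα0 := hα.le
  have hPm : ∀ τ : ℝ, Measurable fun v : EuclideanSpace ℝ d => (modeProfile n β α (α * τ) v).re := fun τ =>
    Complex.measurable_re.comp (measurable_modeProfile_right hβ hα0 n (α * τ))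
  have hQm : ∀ τ : ℝ, Measurable fun v : EuclideanSpace ℝ d => (modeProfile n β α (α * τ) v).im := fun τ =>
    Complex.measurable_im.comp (measurable_modeProfile_right hβ hα0 n (α * τ))
  have hP1 : ∀ (τ : ℝ) (v : EuclideanSpace ℝ d), |(modeProfile n β α (α * τ) v).re| ≤ 1 := fun τ v =>
    abs_re_modeProfile_le hβ hα0 n _ v
  have hQ1 : ∀ (τ : ℝ) (v : EuclideanSpace ℝ d), |(modeProfile n β α (α * τ) v).im| ≤ 1 := fun τ v =>
    abs_im_modeProfile_le hβ hα0 n _ v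
  -- the chain rule
  have hchain : ∀ (v : EuclideanSpace ℝ d) (τ : ℝ), 0 < τ →
      HasDerivAt (fun σ : ℝ => modeProfile n β α (α * σ) v) (α • modeDeriv n β α (α * τ) v) τ := by
    intro v τ hτ
    have hD := hasDerivAt_modeProfile' hβ hα0 n (mul_pos hα hτ) v
    have hlin : HasDerivAt (fun σ : ℝ => α * σ) α τ := by simpa using (hasDerivAt_id τ).const_mul α
    exact hD.scomp τ hlin
  refine ⟨hPm, hQm, hP1, hQ1, fun v => by simp, fun v => by simp, fun v => ?_, fun v => ?_,
    fun v τ hτ => ?_, fun v τ hτ => ?_⟩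
  · exact Complex.continuous_re.comp ((continuous_modeProfile_left hβ hα0 n v).comp (continuous_const.mul continuous_id))
  · exact Complex.continuous_im.comp ((continuous_modeProfile_left hβ hα0 n v).comp (continuous_const.mul continuous_id))
  · have hre := Complex.reCLM.hasFDerivAt.comp_hasDerivAt τ (hchain v τ hτ)
    have hK : linearBoltzmannGain β (fun w => (modeProfile n β α (α * τ) w).re) v =
        carlemanGain β (fun w => (modeProfile n β α (α * τ) w).re) v :=
      linearBoltzmannGain_eq_carlemanGain_of_bounded hd hβ (hPm τ) (hP1 τ) v
    refine hre.congr_deriv ?_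
    rw [Complex.reCLM_apply, Complex.real_smul, Complex.re_ofReal_mul, modeDeriv_re, hK, modePhase_eq_modeFreq]
    ring
  · have him := Complex.imCLM.hasFDerivAt.comp_hasDerivAt τ (hchain v τ hτ)
    have hK : linearBoltzmannGain β (fun w => (modeProfile n β α (α * τ) w).im) v =
        carlemanGain β (fun w => (modeProfile n β α (α * τ) w).im) v :=
      linearBoltzmannGain_eq_carlemanGain_of_bounded hd hβ (hQm τ) (hQ1 τ) v
    refine him.congr_deriv ?_
    rw [Complex.imCLM_apply, Complex.real_smul, Complex.im_ofReal_mul, modeDeriv_im, hK, modePhase_eq_modeFreq]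
    ring


/-! ## Duhamel once more: variation of constants for the rescaled profile -/

/-- **Variation of constants, integral form**: if `G(0) = 1`, `G` and `F` are continuous and
`G' = -z G + F` on `(0, ∞)`, then `G(τ) = e^{-zτ} + ∫₀^τ e^{-z(τ-σ)} F(σ) dσ` for `τ ≥ 0`. [folklore] -/
theorem duhamel_of_hasDerivAt {z : ℂ} {G F : ℝ → ℂ} (hG : Continuous G) (hF : Continuous F) (hG0 : G 0 = 1)
    (hode : ∀ σ : ℝ, 0 < σ → HasDerivAt G (-z * G σ + F σ) σ) {τ : ℝ} (hτ : 0 ≤ τ) :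
    G τ = Complex.exp (-z * τ) + ∫ σ in (0 : ℝ)..τ, Complex.exp (-z * (τ - σ)) * F σ := by
  have hE : ∀ σ : ℝ, HasDerivAt (fun s : ℝ => Complex.exp (z * s)) (Complex.exp (z * σ) * z) σ := by
    intro σ
    have h1 : HasDerivAt (fun s : ℝ => z * s) z σ := by
      simpa using (hasDerivAt_id (σ : ℝ)).ofReal_comp.const_mul z
    exact h1.cexp
  have hP' : ∀ σ : ℝ, 0 < σ → HasDerivAt (fun s : ℝ => Complex.exp (z * s) * G s) (Complex.exp (z * σ) * F σ) σ := by
    intro σ hσ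
    refine ((hE σ).mul (hode σ hσ)).congr_deriv ?_
    ring
  have hPc : Continuous fun s : ℝ => Complex.exp (z * s) * G s :=
    (Complex.continuous_exp.comp (continuous_const.mul Complex.continuous_ofReal)).mul hG
  have hint : IntervalIntegrable (fun σ : ℝ => Complex.exp (z * σ) * F σ) volume 0 τ :=
    ((Complex.continuous_exp.comp (continuous_const.mul Complex.continuous_ofReal)).mul hF).intervalIntegrable _ _
  have hftc := intervalIntegral.integral_eq_sub_of_hasDerivAt_of_le hτ hPc.continuousOn (fun σ hσ => hP' σ hσ.1) hint
  simp only [hG0, mul_one, Complex.ofReal_zero, mul_zero, Complex.exp_zero] at hftc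
  -- `e^{zτ} G τ = 1 + ∫ e^{zσ} F σ`
  have h1 : G τ = Complex.exp (-z * τ) * (Complex.exp (z * τ) * G τ) := by
    rw [← mul_assoc, ← Complex.exp_add]; simp
  rw [h1, show Complex.exp (z * τ) * G τ = 1 + ∫ σ in (0:ℝ)..τ, Complex.exp (z * σ) * F σ by rw [hftc]; ring,
    mul_add, mul_one, ← intervalIntegral.integral_const_mul]
  congr 1
  refine intervalIntegral.integral_congr fun σ _ => ?_
  rw [← mul_assoc, ← Complex.exp_add]
  congr 2
  ring

/-- **The rescaled profile in Duhamel form**: for `τ ≥ 0`,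
`ĝ_n(ατ, v) = e^{-zτ} + ∫₀^τ e^{-z(τ-σ)} α² (K⁺ĝ_n(ασ, ·))(v) dσ`, `z = α² a_β(v) + i α ω_n(v)`
(variation of constants on the pointwise ODE `hasDerivAt_modeProfile`). [cite: BodineauGallagherSaintRaymondInvent2016, (6.2)] -/
theorem modeProfile_duhamel [DecidableEq d] (hβ : 0 < β) (n : d → ℤ) {α : ℝ} (hα : 0 < α)
    (v : EuclideanSpace ℝ d) {τ : ℝ} (hτ : 0 ≤ τ) :
    modeProfile n β α (α * τ) v =
      Complex.exp (-(((α ^ 2 * collisionFrequency β v : ℝ) : ℂ) + ((α * modePhase n v : ℝ) : ℂ) * Complex.I) * τ) +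
        ∫ σ in (0 : ℝ)..τ, Complex.exp (-(((α ^ 2 * collisionFrequency β v : ℝ) : ℂ) +
          ((α * modePhase n v : ℝ) : ℂ) * Complex.I) * (τ - σ)) *
          ((α ^ 2 : ℝ) * cgain β (fun w => modeProfile n β α (α * σ) w) v) := by
  have hα0 := hα.le
  set z : ℂ := ((α ^ 2 * collisionFrequency β v : ℝ) : ℂ) + ((α * modePhase n v : ℝ) : ℂ) * Complex.I with hz
  have hG : Continuous fun σ : ℝ => modeProfile n β α (α * σ) v :=
    (continuous_modeProfile_left hβ hα0 n v).comp (continuous_const.mul continuous_id)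
  have hcurve : Continuous (fun σ : ℝ => ((α * σ, v) : ℝ × EuclideanSpace ℝ d)) := by fun_prop
  have hDc : Continuous ((fun p : ℝ × EuclideanSpace ℝ d => modeDeriv n β α p.1 p.2) ∘
      (fun σ : ℝ => ((α * σ, v) : ℝ × EuclideanSpace ℝ d))) := (continuous_modeDeriv hβ hα0 n).comp hcurve
  set F : ℝ → ℂ := fun σ => (α : ℂ) * ((fun p : ℝ × EuclideanSpace ℝ d => modeDeriv n β α p.1 p.2) ∘
      (fun σ : ℝ => ((α * σ, v) : ℝ × EuclideanSpace ℝ d))) σ + z * modeProfile n β α (α * σ) v with hF_def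
  have hF : Continuous F := (continuous_const.mul hDc).add (continuous_const.mul hG)
  have h0 : (fun σ : ℝ => modeProfile n β α (α * σ) v) 0 = 1 := by
    show modeProfile n β α (α * 0) v = 1
    rw [mul_zero, modeProfile_zero]
  have hode : ∀ σ : ℝ, 0 < σ → HasDerivAt (fun σ : ℝ => modeProfile n β α (α * σ) v)
      (-z * (fun σ : ℝ => modeProfile n β α (α * σ) v) σ + F σ) σ := by
    intro σ hσ
    have hD := hasDerivAt_modeProfile' hβ hα0 n (mul_pos hα hσ) v
    have hlin : HasDerivAt (fun s : ℝ => α * s) α σ := by simpa using (hasDerivAt_id σ).const_mul α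
    refine (hD.scomp σ hlin).congr_deriv ?_
    simp only [hF_def, Function.comp_apply, Complex.real_smul]
    ring
  have hduh := duhamel_of_hasDerivAt hG hF h0 hode hτ
  rw [hduh]
  congr 1
  refine intervalIntegral.integral_congr fun σ _ => ?_
  congr 1
  simp only [hF_def, Function.comp_apply, modeDeriv, hz]
  push_cast
  ring

/-! ## Elementary bounds -/

/-- `|K⁺ g| ≤ K⁺ G` when `|g| ≤ G` pointwise, `G` bounded measurable (monotonicity of the gain). [folklore] -/
theorem abs_carlemanGain_le_carlemanGain (hd : 2 ≤ Fintype.card d) (hβ : 0 < β)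
    {g G : EuclideanSpace ℝ d → ℝ} (hGm : Measurable G) {B : ℝ} (hGB : ∀ w, |G w| ≤ B)
    (hle : ∀ w, |g w| ≤ G w) (v : EuclideanSpace ℝ d) :
    |carlemanGain β g v| ≤ carlemanGain β G v := by
  rw [carlemanGain, carlemanGain]
  refine abs_integral_le_integral_abs.trans (integral_mono_of_nonneg (Eventually.of_forall fun u => abs_nonneg _)
    (integrable_carlemanKernel_mul_of_bounded hd hβ hGm hGB v) (Eventually.of_forall fun u => ?_))
  show |carlemanKernel β v u * g (v + u)| ≤ carlemanKernel β v u * G (v + u)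
  rw [abs_mul, abs_of_nonneg (carlemanKernel_nonneg β v u)]
  exact mul_le_mul_of_nonneg_left (hle _) (carlemanKernel_nonneg β v u)

/-- **The complexified gain is controlled by the gain of the modulus**: `‖K⁺ψ‖ ≤ 2 K⁺‖ψ‖` for
bounded measurable `ψ`. [folklore] -/
theorem norm_cgain_le_carlemanGain_norm (hd : 2 ≤ Fintype.card d) (hβ : 0 < β)
    {ψ : EuclideanSpace ℝ d → ℂ} (hψ : Measurable ψ) {B : ℝ} (hB : ∀ w, ‖ψ w‖ ≤ B) (v : EuclideanSpace ℝ d) :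
    ‖cgain β ψ v‖ ≤ 2 * carlemanGain β (fun w => ‖ψ w‖) v := by
  have hn : Measurable fun w => ‖ψ w‖ := hψ.norm
  have hnB : ∀ w, |‖ψ w‖| ≤ B := fun w => by rw [abs_of_nonneg (norm_nonneg _)]; exact hB w
  have hre : |linearBoltzmannGain β (fun w => (ψ w).re) v| ≤ carlemanGain β (fun w => ‖ψ w‖) v := by
    rw [linearBoltzmannGain_eq_carlemanGain_of_bounded hd hβ (g := fun w => (ψ w).re) (Complex.measurable_re.comp hψ)
      (fun w => (Complex.abs_re_le_norm _).trans (hB w)) v]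
    exact abs_carlemanGain_le_carlemanGain hd hβ hn hnB (fun w => Complex.abs_re_le_norm _) v
  have him : |linearBoltzmannGain β (fun w => (ψ w).im) v| ≤ carlemanGain β (fun w => ‖ψ w‖) v := by
    rw [linearBoltzmannGain_eq_carlemanGain_of_bounded hd hβ (g := fun w => (ψ w).im) (Complex.measurable_im.comp hψ)
      (fun w => (Complex.abs_im_le_norm _).trans (hB w)) v]
    exact abs_carlemanGain_le_carlemanGain hd hβ hn hnB (fun w => Complex.abs_im_le_norm _) v
  refine (Complex.norm_le_abs_re_add_abs_im _).trans ?_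
  rw [cgain_re, cgain_im]
  linarith

/-- **The gain part of the Duhamel formula**: for a continuous `X : ℝ → ℂ` with `‖X σ‖ ≤ C` on
`[0, τ]`, `κ > 0`, `‖∫₀^τ e^{-(κ + iθ)(τ-σ)} α² X(σ) dσ‖ ≤ α² C / κ`. [folklore] -/
theorem norm_integral_duhamel_le {κ θ α C τ : ℝ} (hκ : 0 < κ) (hτ : 0 ≤ τ) {X : ℝ → ℂ}
    (hC : ∀ σ ∈ Icc 0 τ, ‖X σ‖ ≤ C) :
    ‖∫ σ in (0 : ℝ)..τ, Complex.exp (-((κ : ℂ) + (θ : ℂ) * Complex.I) * (τ - σ)) * ((α ^ 2 : ℝ) * X σ)‖ ≤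
      α ^ 2 * C / κ := by
  have hC0 : 0 ≤ C := (norm_nonneg _).trans (hC 0 ⟨le_rfl, hτ⟩)
  have hbound : ∀ σ ∈ Icc 0 τ, ‖Complex.exp (-((κ : ℂ) + (θ : ℂ) * Complex.I) * (τ - σ)) * ((α ^ 2 : ℝ) * X σ)‖ ≤
      Real.exp (-(κ * (τ - σ))) * κ * (α ^ 2 * C / κ) := by
    intro σ hσ
    rw [norm_mul, norm_mul, Complex.norm_real, Real.norm_of_nonneg (sq_nonneg α), Complex.norm_exp]
    have hre : (-((κ : ℂ) + (θ : ℂ) * Complex.I) * (τ - σ)).re = -(κ * (τ - σ)) := by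
      simp only [neg_mul, Complex.neg_re, Complex.mul_re, Complex.add_re, Complex.ofReal_re, Complex.mul_im,
        Complex.ofReal_im, Complex.I_re, Complex.I_im, Complex.add_im, Complex.sub_re, Complex.sub_im,
        mul_zero, mul_one, zero_add, add_zero, sub_zero, sub_self]
    rw [hre]
    have : α ^ 2 * ‖X σ‖ ≤ α ^ 2 * C := mul_le_mul_of_nonneg_left (hC σ hσ) (sq_nonneg α)
    calc Real.exp (-(κ * (τ - σ))) * (α ^ 2 * ‖X σ‖) ≤ Real.exp (-(κ * (τ - σ))) * (α ^ 2 * C) :=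
          mul_le_mul_of_nonneg_left this (Real.exp_pos _).le
      _ = Real.exp (-(κ * (τ - σ))) * κ * (α ^ 2 * C / κ) := by field_simp
  calc ‖∫ σ in (0 : ℝ)..τ, Complex.exp (-((κ : ℂ) + (θ : ℂ) * Complex.I) * (τ - σ)) * ((α ^ 2 : ℝ) * X σ)‖
      ≤ ∫ σ in (0 : ℝ)..τ, Real.exp (-(κ * (τ - σ))) * κ * (α ^ 2 * C / κ) := by
        refine intervalIntegral.norm_integral_le_of_norm_le hτ (Eventually.of_forall fun σ hσ => hbound σ ⟨hσ.1.le, hσ.2⟩) ?_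
        exact ((by fun_prop : Continuous fun σ => Real.exp (-(κ * (τ - σ))) * κ * (α ^ 2 * C / κ))).intervalIntegrable _ _
    _ = (1 - Real.exp (-(κ * τ))) * (α ^ 2 * C / κ) := by
        rw [intervalIntegral.integral_mul_const, integral_mul_exp_neg_mul_sub]
    _ ≤ 1 * (α ^ 2 * C / κ) := by
        refine mul_le_mul_of_nonneg_right ?_ (by positivity)
        linarith [Real.exp_pos (-(κ * τ))]
    _ = α ^ 2 * C / κ := one_mul _

/-- `K α^{-p} ≤ e` as soon as `α ≥ (K/e)^{1/p}` (`p, K, e > 0`). [folklore] -/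
theorem mul_rpow_neg_le {p K e α : ℝ} (hp : 0 < p) (hK : 0 < K) (he : 0 < e) (hα : (K / e) ^ (1 / p) ≤ α) :
    K * α ^ (-p) ≤ e := by
  have hKe : 0 < K / e := div_pos hK he
  have hα0 : 0 < α := lt_of_lt_of_le (Real.rpow_pos_of_pos hKe _) hα
  have h1 : K / e ≤ α ^ p := by
    have := Real.rpow_le_rpow (Real.rpow_nonneg hKe.le _) hα hp.le
    rwa [← Real.rpow_mul hKe.le, one_div_mul_cancel hp.ne', Real.rpow_one] at this
  rw [Real.rpow_neg hα0.le, ← div_eq_mul_inv, div_le_iff₀ (Real.rpow_pos_of_pos hα0 _)]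
  rw [div_le_iff₀ he] at h1
  linarith [mul_comm e (α ^ p)]


/-! ## The relaxation of the velocity profile: auxiliary lemmas -/

/-- `‖h‖_{L¹(M)} ≤ (α⁻¹ + α ‖h‖²_{L²(M)})/2`. [folklore] -/
theorem integral_norm_le_of_sq {h : EuclideanSpace ℝ d → ℂ} {α : ℝ} (hα : 0 < α)
    (h1 : Integrable fun w => ‖h w‖ * maxwellianBeta β w) (h2 : Integrable fun w => ‖h w‖ ^ 2 * maxwellianBeta β w)
    (hβ : 0 < β) :
    ∫ w, ‖h w‖ * maxwellianBeta β w ≤ (α⁻¹ + α * ∫ w, ‖h w‖ ^ 2 * maxwellianBeta β w) / 2 := by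
  have hM := KineticTheory.integrable_maxwellianBeta (d := d) hβ
  have hpt : ∀ w, ‖h w‖ * maxwellianBeta β w ≤ ((α⁻¹ + α * ‖h w‖ ^ 2) / 2) * maxwellianBeta β w := fun w => by
    refine mul_le_mul_of_nonneg_right ?_ (maxwellianBeta_pos hβ w).le
    rw [le_div_iff₀ two_pos]
    have h0 : 0 ≤ (α * ‖h w‖ - 1) ^ 2 / α := by positivity
    have e : (α * ‖h w‖ - 1) ^ 2 / α = α⁻¹ + α * ‖h w‖ ^ 2 - ‖h w‖ * 2 := by field_simp; ring
    linarith only [h0, e]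
  calc ∫ w, ‖h w‖ * maxwellianBeta β w ≤ ∫ w, ((α⁻¹ + α * ‖h w‖ ^ 2) / 2) * maxwellianBeta β w :=
        integral_mono h1 (((hM.const_mul α⁻¹).add (h2.const_mul α)).div_const 2 |>.congr
          (Eventually.of_forall fun w => by simp only [Pi.add_apply]; ring)) hpt
    _ = (α⁻¹ + α * ∫ w, ‖h w‖ ^ 2 * maxwellianBeta β w) / 2 := by
        have e : (fun w => ((α⁻¹ + α * ‖h w‖ ^ 2) / 2) * maxwellianBeta β w) = fun w =>
            (α⁻¹ / 2) * maxwellianBeta β w + (α / 2) * (‖h w‖ ^ 2 * maxwellianBeta β w) := by funext w; ring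
        rw [e, integral_add (hM.const_mul _) (h2.const_mul _), integral_const_mul, integral_const_mul,
          KineticTheory.integral_maxwellianBeta hβ]
        ring

/-- The explicit Duhamel integral: `∫₀^τ e^{-z(τ-σ)} A e^{-λσ} dσ = A (e^{-λτ} - e^{-zτ})/(z - λ)` for
`z ≠ λ`. [folklore] -/
theorem integral_exp_duhamel_explicit {z : ℂ} {lam : ℝ} (A : ℂ) (hzl : z - (lam : ℂ) ≠ 0) (τ : ℝ) :
    ∫ σ in (0 : ℝ)..τ, Complex.exp (-z * (τ - σ)) * (A * Complex.exp (-(lam : ℂ) * σ)) =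
      A * (Complex.exp (-(lam : ℂ) * τ) - Complex.exp (-z * τ)) / (z - lam) := by
  have hΦ : ∀ σ : ℝ, HasDerivAt (fun s : ℝ => A * Complex.exp (-z * τ + (z - lam) * s) / (z - lam))
      (Complex.exp (-z * (τ - σ)) * (A * Complex.exp (-(lam : ℂ) * σ))) σ := by
    intro σ
    have h1 : HasDerivAt (fun s : ℝ => -z * τ + (z - lam) * s) (z - lam) σ := by
      simpa using ((hasDerivAt_id (σ : ℝ)).ofReal_comp.const_mul (z - lam)).const_add (-z * τ)
    have h2 := ((h1.cexp).const_mul A).div_const (z - lam)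
    refine h2.congr_deriv ?_
    rw [show -z * (τ : ℂ) + (z - lam) * σ = -z * (τ - σ) + -(lam : ℂ) * σ by ring, Complex.exp_add]
    field_simp
  rw [intervalIntegral.integral_eq_sub_of_hasDerivAt (fun σ _ => hΦ σ)
    (((Complex.continuous_exp.comp (by fun_prop)).mul (by fun_prop)).intervalIntegrable _ _)]
  simp only [Complex.ofReal_zero, mul_zero, add_zero]
  rw [show -z * (τ : ℂ) + (z - lam) * τ = -(lam : ℂ) * τ by ring]
  field_simp

/-- The algebra of the explicit part: with `z = A + iB`, `e^{-zτ} - L + A(L - e^{-zτ})/(z - λ) =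
(L - e^{-zτ})(λ - iB)/(z - λ)`. [folklore] -/
theorem explicit_part_algebra {A B lam : ℝ} {L X : ℂ} (hzl : ((A : ℂ) + (B : ℂ) * Complex.I) - (lam : ℂ) ≠ 0) :
    X - L + (A : ℂ) * (L - X) / (((A : ℂ) + (B : ℂ) * Complex.I) - lam) =
      (L - X) * ((lam : ℂ) - (B : ℂ) * Complex.I) / (((A : ℂ) + (B : ℂ) * Complex.I) - lam) := by
  field_simp
  ring

/-- `‖h σ‖²` in terms of the deviation components: for reals `re, im, E, y`,
`(re - E)² + im² ≤ 2((re - E)² + (im + y)²) + 2 y²`. [folklore] -/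
theorem sq_dev_le (re im E y : ℝ) : (re - E) ^ 2 + im ^ 2 ≤ 2 * ((re - E) ^ 2 + (im + y) ^ 2) + 2 * y ^ 2 := by
  nlinarith [sq_nonneg (im + 2 * y), sq_nonneg (re - E)]


/-! ## The relaxation of the velocity profile -/

/-- **`L²(M_β)` smallness of `h = ĝ(α·) - e^{-λ·}` from the energy**: for `σ ≥ 0`,
`∫ ‖ĝ_n(ασ, w) - e^{-λσ}‖² M_β(w) dw ≤ 2 y(σ) + 2 α⁻² ∫ ω_b² M_β` (`Q² ≤ 2(Q + Eω_b/α)² + 2ω_b²/α²`).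
[folklore] -/
theorem integral_normSq_profile_sub_le [DecidableEq d] (hd : 2 ≤ Fintype.card d) (hβ : 0 < β)
    {b : EuclideanSpace ℝ d → EuclideanSpace ℝ d} (hb : IsDiffusionCorrector β b) (n : d → ℤ) {α : ℝ} (hα : 0 < α)
    {σ : ℝ} (hσ : 0 ≤ σ) :
    ∫ w, ‖modeProfile n β α (α * σ) w - (modeMult β b n σ : ℂ)‖ ^ 2 * maxwellianBeta β w ≤
      2 * modeEnergy β b n α (fun τ v => (modeProfile n β α (α * τ) v).re) (fun τ v => (modeProfile n β α (α * τ) v).im) σ +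
        2 / α ^ 2 * ∫ w, modeCorrector n b w ^ 2 * maxwellianBeta β w := by
  have hpair := isModePair_modeProfile hd hβ n hα
  have hp := hpair.finiteEnergy_devFst (b := b) hβ σ
  have hq := hpair.finiteEnergy_devSnd hβ hb σ
  have hwb := finiteEnergy_modeCorrector hβ n hb
  have hlam := IsModePair.modeRate_nonneg hd hβ hb n
  have hE1 := IsModePair.modeMult_le_one hlam hσ
  have hE0 := (modeMult_pos β b n σ).le
  have ip := integrable_sq_mul_maxwellianBeta_of_finiteEnergy hd hβ hp
  have iq := integrable_sq_mul_maxwellianBeta_of_finiteEnergy hd hβ hq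
  have iw := integrable_sq_mul_maxwellianBeta_of_finiteEnergy hd hβ hwb
  have ipq : Integrable fun w => devFst β b n (fun τ v => (modeProfile n β α (α * τ) v).re) σ w ^ 2 * maxwellianBeta β w +
      devSnd β b n α (fun τ v => (modeProfile n β α (α * τ) v).im) σ w ^ 2 * maxwellianBeta β w := ip.add iq
  have hpt : ∀ w, ‖modeProfile n β α (α * σ) w - (modeMult β b n σ : ℂ)‖ ^ 2 * maxwellianBeta β w ≤
      2 * ((devFst β b n (fun τ v => (modeProfile n β α (α * τ) v).re) σ w ^ 2 * maxwellianBeta β w +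
        devSnd β b n α (fun τ v => (modeProfile n β α (α * τ) v).im) σ w ^ 2 * maxwellianBeta β w)) +
        2 / α ^ 2 * (modeCorrector n b w ^ 2 * maxwellianBeta β w) := by
    intro w
    have hM := (maxwellianBeta_pos hβ w).le
    have hn2 : ‖modeProfile n β α (α * σ) w - (modeMult β b n σ : ℂ)‖ ^ 2 =
        ((modeProfile n β α (α * σ) w).re - modeMult β b n σ) ^ 2 + (modeProfile n β α (α * σ) w).im ^ 2 := by
      rw [Complex.sq_norm, Complex.normSq_apply, Complex.sub_re, Complex.sub_im, Complex.ofReal_re,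
        Complex.ofReal_im, sub_zero]
      ring
    have hdev1 : devFst β b n (fun τ v => (modeProfile n β α (α * τ) v).re) σ w =
        (modeProfile n β α (α * σ) w).re - modeMult β b n σ := rfl
    have hdev2 : devSnd β b n α (fun τ v => (modeProfile n β α (α * τ) v).im) σ w =
        (modeProfile n β α (α * σ) w).im + modeMult β b n σ * modeCorrector n b w / α := rfl
    rw [hn2, hdev1, hdev2]
    have i1 := sq_dev_le (modeProfile n β α (α * σ) w).re (modeProfile n β α (α * σ) w).im (modeMult β b n σ)
      (modeMult β b n σ * modeCorrector n b w / α)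
    have i2 : (modeMult β b n σ * modeCorrector n b w / α) ^ 2 ≤ modeCorrector n b w ^ 2 / α ^ 2 := by
      rw [div_pow, mul_pow]
      have hE2 : modeMult β b n σ ^ 2 ≤ 1 := by nlinarith only [hE0, hE1]
      have h0 : 0 ≤ modeCorrector n b w ^ 2 / α ^ 2 := by positivity
      calc modeMult β b n σ ^ 2 * modeCorrector n b w ^ 2 / α ^ 2
          = modeMult β b n σ ^ 2 * (modeCorrector n b w ^ 2 / α ^ 2) := by ring
        _ ≤ 1 * (modeCorrector n b w ^ 2 / α ^ 2) := mul_le_mul_of_nonneg_right hE2 h0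
        _ = modeCorrector n b w ^ 2 / α ^ 2 := one_mul _
    have i2' := mul_le_mul_of_nonneg_left i2 two_pos.le
    have i12 : ((modeProfile n β α (α * σ) w).re - modeMult β b n σ) ^ 2 + (modeProfile n β α (α * σ) w).im ^ 2 ≤
        2 * (((modeProfile n β α (α * σ) w).re - modeMult β b n σ) ^ 2 +
          ((modeProfile n β α (α * σ) w).im + modeMult β b n σ * modeCorrector n b w / α) ^ 2) +
          2 * (modeCorrector n b w ^ 2 / α ^ 2) := by linarith only [i1, i2']
    have i3 := mul_le_mul_of_nonneg_right i12 hM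
    have e : (2 * (((modeProfile n β α (α * σ) w).re - modeMult β b n σ) ^ 2 +
        ((modeProfile n β α (α * σ) w).im + modeMult β b n σ * modeCorrector n b w / α) ^ 2) +
        2 * (modeCorrector n b w ^ 2 / α ^ 2)) * maxwellianBeta β w =
        2 * (((modeProfile n β α (α * σ) w).re - modeMult β b n σ) ^ 2 * maxwellianBeta β w +
          ((modeProfile n β α (α * σ) w).im + modeMult β b n σ * modeCorrector n b w / α) ^ 2 * maxwellianBeta β w) +
          2 / α ^ 2 * (modeCorrector n b w ^ 2 * maxwellianBeta β w) := by ring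
    linarith only [i3, e]
  have hmeas : Measurable fun w => modeProfile n β α (α * σ) w - (modeMult β b n σ : ℂ) :=
    (measurable_modeProfile_right hβ hα.le n _).sub measurable_const
  have h3 : ∀ w, ‖modeProfile n β α (α * σ) w - (modeMult β b n σ : ℂ)‖ ≤ 3 := fun w => by
    refine (norm_sub_le _ _).trans ?_
    rw [Complex.norm_real, Real.norm_of_nonneg hE0]
    linarith only [norm_modeProfile_le hβ hα.le n (α * σ) w, hE1]
  have hint : Integrable fun w => ‖modeProfile n β α (α * σ) w - (modeMult β b n σ : ℂ)‖ ^ 2 * maxwellianBeta β w := by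
    refine ((KineticTheory.integrable_maxwellianBeta (d := d) hβ).const_mul 9).mono'
      ((hmeas.norm.pow_const 2).mul (measurable_maxwellianBeta β)).aestronglyMeasurable (Eventually.of_forall fun w => ?_)
    rw [Real.norm_of_nonneg (mul_nonneg (sq_nonneg _) (maxwellianBeta_pos hβ w).le)]
    have h9 : ‖modeProfile n β α (α * σ) w - (modeMult β b n σ : ℂ)‖ ^ 2 ≤ 9 := by
      nlinarith only [h3 w, norm_nonneg (modeProfile n β α (α * σ) w - (modeMult β b n σ : ℂ))]
    nlinarith only [h9, (maxwellianBeta_pos hβ w).le]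
  calc ∫ w, ‖modeProfile n β α (α * σ) w - (modeMult β b n σ : ℂ)‖ ^ 2 * maxwellianBeta β w
      ≤ ∫ w, (2 * ((devFst β b n (fun τ v => (modeProfile n β α (α * τ) v).re) σ w ^ 2 * maxwellianBeta β w +
          devSnd β b n α (fun τ v => (modeProfile n β α (α * τ) v).im) σ w ^ 2 * maxwellianBeta β w)) +
          2 / α ^ 2 * (modeCorrector n b w ^ 2 * maxwellianBeta β w)) :=
        integral_mono hint ((ipq.const_mul 2).add (iw.const_mul _)) hpt
    _ = _ := by
        rw [integral_add (ipq.const_mul 2) (iw.const_mul _), integral_const_mul, integral_const_mul, modeEnergy]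
        congr 2
        exact integral_congr_ae (Eventually.of_forall fun w => by ring)

/-- **The gain of the profile splits off the gain of the constant**: with `h(σ) = ĝ(ασ, ·) - E(σ)`,
`K⁺ĝ(ασ, ·)(v) = K⁺h(σ)(v) + E(σ) a_β(v)` (`K⁺1 = a_β`). [folklore] -/
theorem cgain_profile_eq [DecidableEq d] (hd : 2 ≤ Fintype.card d) (hβ : 0 < β)
    (b : EuclideanSpace ℝ d → EuclideanSpace ℝ d) (n : d → ℤ) {α : ℝ} (hα : 0 ≤ α) (hlam : 0 ≤ modeRate β b n)
    {σ : ℝ} (hσ : 0 ≤ σ) (v : EuclideanSpace ℝ d) :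
    cgain β (fun w => modeProfile n β α (α * σ) w) v =
      cgain β (fun w => modeProfile n β α (α * σ) w - (modeMult β b n σ : ℂ)) v +
        ((modeMult β b n σ * collisionFrequency β v : ℝ) : ℂ) := by
  have hE0 := (modeMult_pos β b n σ).le
  have hE1 := IsModePair.modeMult_le_one hlam hσ
  have hmG := measurable_modeProfile_right hβ hα n (α * σ)
  have hmh : Measurable fun w => (modeProfile n β α (α * σ) w - (modeMult β b n σ : ℂ)).re :=
    Complex.measurable_re.comp (hmG.sub measurable_const)
  have hreG : ∀ w, |(modeProfile n β α (α * σ) w).re| ≤ 1 := fun w => abs_re_modeProfile_le hβ hα n _ w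
  have hreh : ∀ w, |(modeProfile n β α (α * σ) w - (modeMult β b n σ : ℂ)).re| ≤ 2 := fun w => by
    rw [Complex.sub_re, Complex.ofReal_re]
    have := hreG w
    rw [abs_le] at this ⊢
    constructor <;> linarith only [this.1, this.2, hE0, hE1]
  have e_re : (fun w => (modeProfile n β α (α * σ) w).re) =
      fun w => (modeProfile n β α (α * σ) w - (modeMult β b n σ : ℂ)).re + modeMult β b n σ := by
    funext w; simp
  have e_im : (fun w => (modeProfile n β α (α * σ) w).im) =
      fun w => (modeProfile n β α (α * σ) w - (modeMult β b n σ : ℂ)).im := by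
    funext w; simp
  apply Complex.ext
  · rw [cgain_re, Complex.add_re, cgain_re, Complex.ofReal_re,
      linearBoltzmannGain_eq_carlemanGain_of_bounded hd hβ (g := fun w => (modeProfile n β α (α * σ) w).re)
        (Complex.measurable_re.comp hmG) hreG,
      linearBoltzmannGain_eq_carlemanGain_of_bounded hd hβ
        (g := fun w => (modeProfile n β α (α * σ) w - (modeMult β b n σ : ℂ)).re) hmh hreh, e_re,
      carlemanGain_add_const_of_bounded hd hβ hmh hreh]
  · rw [cgain_im, Complex.add_im, cgain_im, Complex.ofReal_im, add_zero, e_im]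

/-- **Relaxation of the velocity profile** (the velocity-only form of BGSR (6.3)): for `d ≥ 2`,
`β > 0`, a corrector `b`, a mode `n`, `T > 0` and `e > 0` there is `α₀ ≥ 0` such that for
`α ≥ α₀`, `τ ∈ [0, T]` and all `v`, `M_β(v) |ĝ_n(ατ, v) - e^{-4π² κ_β |n|² τ}| ≤ e`.
[cite: BodineauGallagherSaintRaymondInvent2016, (6.3) and §6.1.2–6.1.3] -/
theorem modeProfile_relaxation [DecidableEq d] (hd : 2 ≤ Fintype.card d) {β : ℝ} (hβ : 0 < β)
    (b : EuclideanSpace ℝ d → EuclideanSpace ℝ d) (hb : IsDiffusionCorrector β b) (n : d → ℤ)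
    {T : ℝ} (hT : 0 < T) {e : ℝ} (he : 0 < e) :
    ∃ α₀ : ℝ, 0 ≤ α₀ ∧ ∀ α : ℝ, α₀ ≤ α → ∀ τ ∈ Icc 0 T, ∀ v : EuclideanSpace ℝ d,
      maxwellianBeta β v * ‖modeProfile n β α (α * τ) v -
        (Real.exp (-(4 * Real.pi ^ 2 * bgsrDiffusionCoeff β b *
          ‖(Literature.Analysis.FunctionSpaces.Torus.latticeVec n : EuclideanSpace ℝ d)‖ ^ 2 * τ)) : ℂ)‖ ≤ e := by
  -- constants
  obtain ⟨a₀, ha₀, c, hc, hlow⟩ := exists_collisionFrequency_lowerBound (d := d) hd hβ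
  have hlam : 0 ≤ modeRate β b n := IsModePair.modeRate_nonneg hd hβ hb n
  have hCω0 : 0 ≤ ‖(modeVec n : EuclideanSpace ℝ d)‖ / c := div_nonneg (norm_nonneg _) hc.le
  have hM₀pos : 0 < (2 * Real.pi * β⁻¹) ^ (-(Module.finrank ℝ (EuclideanSpace ℝ d) : ℝ) / 2) :=
    Real.rpow_pos_of_pos (by positivity) _
  have hW0 : 0 ≤ ∫ v, modeCorrector n b v ^ 2 * maxwellianBeta β v :=
    integral_nonneg fun v => mul_nonneg (sq_nonneg _) (maxwellianBeta_pos hβ v).le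
  obtain ⟨CT, hCT0, hCT⟩ := IsModePair.modeEnergy_le hd hβ hb n hT.le
  -- kernel moment with `θ = 1/d`
  have hcard : (2 : ℝ) ≤ Fintype.card d := by exact_mod_cast hd
  have hθ0 : 0 < 1 / (Fintype.card d : ℝ) := by positivity
  have hθ1 : 1 / (Fintype.card d : ℝ) ≤ 1 := by rw [div_le_one (by linarith only [hcard])]; linarith only [hcard]
  have hθd : 1 / (Fintype.card d : ℝ) * (Fintype.card d - 2 : ℕ) ≤ 1 := by
    rw [Nat.cast_sub (le_trans (by norm_num) hd), Nat.cast_two, div_mul_eq_mul_div, one_mul,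
      div_le_one (by linarith only [hcard])]
    linarith only [hcard]
  obtain ⟨Cθ, hCθlt, hCθ⟩ := exists_lintegral_carlemanKernel_mul_rpow_le hd hβ hθ0 hθd
  -- names for the constants
  set θ : ℝ := 1 / (Fintype.card d : ℝ) with hθ
  set lam := modeRate β b n with hlam_def
  set Cω : ℝ := ‖(modeVec n : EuclideanSpace ℝ d)‖ / c with hCω
  set M₀ : ℝ := (2 * Real.pi * β⁻¹) ^ (-(Module.finrank ℝ (EuclideanSpace ℝ d) : ℝ) / 2) with hM₀
  set W : ℝ := ∫ v, modeCorrector n b v ^ 2 * maxwellianBeta β v with hW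
  set KL : ℝ := (1 + 2 * CT + 2 * W) / 2 with hKL
  have hKL0 : 0 ≤ KL := by positivity
  set K₁ : ℝ := M₀ * (4 * lam / a₀ + 4 * Cω) + 1 with hK₁
  set K₂ : ℝ := 4 * KL * M₀ / a₀ + 1 with hK₂
  set K₃ : ℝ := 6 * Cθ.toReal * M₀ ^ (1 - θ) / a₀ + 1 with hK₃
  have hK₁pos : 0 < K₁ := by positivity
  have hK₂pos : 0 < K₂ := by positivity
  have hK₃pos : 0 < K₃ := by positivity
  have he3 : 0 < e / 3 := by positivity
  refine ⟨max (max 1 (2 * lam / a₀ + 1)) (max ((K₁ / (e / 3)) ^ (1 / (1 : ℝ)))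
    (max ((K₂ / (e / 3)) ^ (1 / (1 / 2 : ℝ))) ((K₃ / (e / 3)) ^ (1 / (θ / 2))))), by positivity, ?_⟩
  intro α hα τ hτ v
  have hα1 : 1 ≤ α := le_trans (le_max_left _ _) ((le_max_left _ _).trans hα)
  have hα0 : 0 < α := by linarith only [hα1]
  have hαlam : 2 * lam / a₀ + 1 ≤ α := le_trans (le_max_right _ _) ((le_max_left _ _).trans hα)
  have hαK₁ : (K₁ / (e / 3)) ^ (1 / (1 : ℝ)) ≤ α := le_trans (le_max_left _ _) ((le_max_right _ _).trans hα)
  have hαK₂ : (K₂ / (e / 3)) ^ (1 / (1 / 2 : ℝ)) ≤ α :=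
    le_trans (le_max_left _ _) ((le_max_right _ _).trans ((le_max_right _ _).trans hα))
  have hαK₃ : (K₃ / (e / 3)) ^ (1 / (θ / 2)) ≤ α :=
    le_trans (le_max_right _ _) ((le_max_right _ _).trans ((le_max_right _ _).trans hα))
  -- at the point `v`
  have ha := (hlow v).1
  have hav : 0 < collisionFrequency β v := ha₀.trans_le ha
  have hMv := maxwellianBeta_pos hβ v
  have hMle : maxwellianBeta β v ≤ M₀ := maxwellianBeta_le hβ v
  set a := collisionFrequency β v with ha_def
  set ω := modePhase n v with hω_def
  have hω : |ω| ≤ Cω * a := by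
    rw [hω_def, modePhase_eq_modeFreq]
    calc |modeFreq n v| ≤ ‖(modeVec n : EuclideanSpace ℝ d)‖ * ‖v‖ := abs_modeFreq_le n v
      _ = Cω * (c * ‖v‖) := by rw [hCω]; field_simp
      _ ≤ Cω * a := mul_le_mul_of_nonneg_left (hlow v).2 hCω0
  have hbig : 2 * lam ≤ α ^ 2 * a := by
    have h1 : (2 * lam / a₀ + 1) * a₀ = 2 * lam + a₀ := by field_simp
    have h2 : (2 * lam / a₀ + 1) * a₀ ≤ α * a := mul_le_mul hαlam ha ha₀.le hα0.le
    have h3' : 0 ≤ (α - 1) * a := mul_nonneg (by linarith only [hα1]) hav.le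
    have h3 : α * a ≤ α ^ 2 * a := by nlinarith only [h3', hα0.le]
    linarith only [h1, h2, h3, ha₀]
  rw [heatExponent_eq_modeRate]
  -- Step 1: energy and `L¹(M)` smallness of `h(σ) = ĝ(ασ) - E(σ)` for `σ ∈ [0, T]`
  have hpair := isModePair_modeProfile hd hβ n hα0
  have hL1 : ∀ σ ∈ Icc 0 T, ∫ w, ‖modeProfile n β α (α * σ) w - (modeMult β b n σ : ℂ)‖ * maxwellianBeta β w ≤ KL / α := by
    intro σ hσ
    have hE0 := (modeMult_pos β b n σ).le
    have hE1 := IsModePair.modeMult_le_one hlam hσ.1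
    have hmeas : Measurable fun w => modeProfile n β α (α * σ) w - (modeMult β b n σ : ℂ) :=
      (measurable_modeProfile_right hβ hα0.le n _).sub measurable_const
    have h3 : ∀ w, ‖modeProfile n β α (α * σ) w - (modeMult β b n σ : ℂ)‖ ≤ 3 := fun w => by
      refine (norm_sub_le _ _).trans ?_
      rw [Complex.norm_real, Real.norm_of_nonneg hE0]
      linarith only [norm_modeProfile_le hβ hα0.le n (α * σ) w, hE1]
    have i1 : Integrable fun w => ‖modeProfile n β α (α * σ) w - (modeMult β b n σ : ℂ)‖ * maxwellianBeta β w := by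
      refine ((KineticTheory.integrable_maxwellianBeta (d := d) hβ).const_mul 3).mono'
        (hmeas.norm.mul (measurable_maxwellianBeta β)).aestronglyMeasurable (Eventually.of_forall fun w => ?_)
      rw [Real.norm_of_nonneg (mul_nonneg (norm_nonneg _) (maxwellianBeta_pos hβ w).le)]
      exact mul_le_mul_of_nonneg_right (h3 w) (maxwellianBeta_pos hβ w).le
    have i2 : Integrable fun w => ‖modeProfile n β α (α * σ) w - (modeMult β b n σ : ℂ)‖ ^ 2 * maxwellianBeta β w := by
      refine ((KineticTheory.integrable_maxwellianBeta (d := d) hβ).const_mul 9).mono'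
        ((hmeas.norm.pow_const 2).mul (measurable_maxwellianBeta β)).aestronglyMeasurable (Eventually.of_forall fun w => ?_)
      rw [Real.norm_of_nonneg (mul_nonneg (sq_nonneg _) (maxwellianBeta_pos hβ w).le)]
      have h9 : ‖modeProfile n β α (α * σ) w - (modeMult β b n σ : ℂ)‖ ^ 2 ≤ 9 := by
        nlinarith only [h3 w, norm_nonneg (modeProfile n β α (α * σ) w - (modeMult β b n σ : ℂ))]
      nlinarith only [h9, (maxwellianBeta_pos hβ w).le]
    have hL2 := integral_normSq_profile_sub_le hd hβ hb n hα0 hσ.1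
    have hy := hCT α hα1 _ _ hpair σ hσ
    refine (integral_norm_le_of_sq hα0 i1 i2 hβ).trans ?_
    have hR : ∫ w, ‖modeProfile n β α (α * σ) w - (modeMult β b n σ : ℂ)‖ ^ 2 * maxwellianBeta β w ≤
        2 * (CT / α ^ 2) + 2 / α ^ 2 * W := by linarith only [hL2, hy]
    calc (α⁻¹ + α * ∫ w, ‖modeProfile n β α (α * σ) w - (modeMult β b n σ : ℂ)‖ ^ 2 * maxwellianBeta β w) / 2
        ≤ (α⁻¹ + α * (2 * (CT / α ^ 2) + 2 / α ^ 2 * W)) / 2 := by gcongr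
      _ = KL / α := by rw [hKL]; field_simp; ring
  -- Step 2: the uniform bound on the gain of `h(σ)` at `v`, `σ ∈ [0, τ]`
  have hΛpos : 0 < α ^ (1 / 2 : ℝ) := Real.rpow_pos_of_pos hα0 _
  set Cv : ℝ := 2 * (α ^ (1 / 2 : ℝ) * (KL / α) + 3 * (α ^ (1 / 2 : ℝ)) ^ (-θ) * maxwellianBeta β v ^ (-θ) * Cθ.toReal)
    with hCv
  have hcg : ∀ σ ∈ Icc 0 τ, ‖cgain β (fun w => modeProfile n β α (α * σ) w - (modeMult β b n σ : ℂ)) v‖ ≤ Cv := by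
    intro σ hσ
    have hE0 := (modeMult_pos β b n σ).le
    have hE1 := IsModePair.modeMult_le_one hlam hσ.1
    have hmeas : Measurable fun w => modeProfile n β α (α * σ) w - (modeMult β b n σ : ℂ) :=
      (measurable_modeProfile_right hβ hα0.le n _).sub measurable_const
    have h3 : ∀ w, ‖modeProfile n β α (α * σ) w - (modeMult β b n σ : ℂ)‖ ≤ 3 := fun w => by
      refine (norm_sub_le _ _).trans ?_
      rw [Complex.norm_real, Real.norm_of_nonneg hE0]
      linarith only [norm_modeProfile_le hβ hα0.le n (α * σ) w, hE1]
    refine (norm_cgain_le_carlemanGain_norm hd hβ hmeas h3 v).trans ?_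
    rw [hCv]
    refine mul_le_mul_of_nonneg_left ?_ two_pos.le
    have hs := integral_carlemanKernel_mul_le_split hd hβ hθ0 hCθlt hCθ
      (h := fun w => ‖modeProfile n β α (α * σ) w - (modeMult β b n σ : ℂ)‖) hmeas.norm
      (B := 3) (fun w => norm_nonneg _) h3 hΛpos v
    rw [carlemanGain]
    refine hs.trans (add_le_add ?_ le_rfl)
    exact mul_le_mul_of_nonneg_left (hL1 σ ⟨hσ.1, hσ.2.trans hτ.2⟩) hΛpos.le
  -- Step 3: the Duhamel decomposition at `(τ, v)`
  set z : ℂ := ((α ^ 2 * a : ℝ) : ℂ) + ((α * ω : ℝ) : ℂ) * Complex.I with hz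
  have hzre : (z - (lam : ℂ)).re = α ^ 2 * a - lam := by
    rw [hz]
    simp only [Complex.sub_re, Complex.add_re, Complex.mul_re, Complex.ofReal_re, Complex.ofReal_im,
      Complex.I_re, Complex.I_im, mul_zero, mul_one, sub_zero, add_zero]
  have hzl : z - (lam : ℂ) ≠ 0 := fun h0 => by
    have h1 := congrArg Complex.re h0
    rw [hzre, Complex.zero_re] at h1
    have h2 : 0 < α ^ 2 * a := by positivity
    linarith only [h1, hbig, h2, hlam]
  set X : ℝ → ℂ := fun σ => cgain β (fun w => modeProfile n β α (α * σ) w - (modeMult β b n σ : ℂ)) v with hX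
  have hXb : ∀ σ ∈ Icc 0 τ, ‖X σ‖ ≤ Cv := hcg
  have hduh := modeProfile_duhamel hβ n hα0 v hτ.1
  have hmult : ∀ σ : ℝ, (modeMult β b n σ : ℂ) = Complex.exp (-(lam : ℂ) * σ) := fun σ => by
    rw [modeMult, Complex.ofReal_exp, ← hlam_def]
    congr 1
    push_cast
    ring
  have hFX : ∀ σ : ℝ, 0 ≤ σ → Complex.exp (-z * (τ - σ)) * ((α ^ 2 : ℝ) * cgain β (fun w => modeProfile n β α (α * σ) w) v) =
      Complex.exp (-z * (τ - σ)) * ((α ^ 2 : ℝ) * X σ) +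
        Complex.exp (-z * (τ - σ)) * (((α ^ 2 * a : ℝ) : ℂ) * Complex.exp (-(lam : ℂ) * σ)) := by
    intro σ hσ
    rw [cgain_profile_eq hd hβ b n hα0.le hlam hσ v, hX]
    push_cast
    rw [hmult σ]
    ring
  have hcont1 : Continuous fun σ : ℝ => Complex.exp (-z * (τ - σ)) * (((α ^ 2 * a : ℝ) : ℂ) * Complex.exp (-(lam : ℂ) * σ)) := by
    fun_prop
  have hint_total : IntervalIntegrable (fun σ : ℝ => Complex.exp (-z * (τ - σ)) *
      ((α ^ 2 : ℝ) * cgain β (fun w => modeProfile n β α (α * σ) w) v)) volume 0 τ := by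
    -- continuous: `α² K⁺ĝ = α Γ + z ĝ` with `Γ = modeDeriv` jointly continuous
    have hG : Continuous fun σ : ℝ => modeProfile n β α (α * σ) v :=
      (continuous_modeProfile_left hβ hα0.le n v).comp (continuous_const.mul continuous_id)
    have hcurve : Continuous (fun σ : ℝ => ((α * σ, v) : ℝ × EuclideanSpace ℝ d)) := by fun_prop
    have hDc : Continuous ((fun p : ℝ × EuclideanSpace ℝ d => modeDeriv n β α p.1 p.2) ∘
        (fun σ : ℝ => ((α * σ, v) : ℝ × EuclideanSpace ℝ d))) := (continuous_modeDeriv hβ hα0.le n).comp hcurve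
    have hF : Continuous fun σ : ℝ => (α : ℂ) * ((fun p : ℝ × EuclideanSpace ℝ d => modeDeriv n β α p.1 p.2) ∘
        (fun σ : ℝ => ((α * σ, v) : ℝ × EuclideanSpace ℝ d))) σ +
        (((α ^ 2 * collisionFrequency β v : ℝ) : ℂ) + ((α * modePhase n v : ℝ) : ℂ) * Complex.I) *
          modeProfile n β α (α * σ) v := (continuous_const.mul hDc).add (continuous_const.mul hG)
    have hFe : (fun σ : ℝ => ((α ^ 2 : ℝ) : ℂ) * cgain β (fun w => modeProfile n β α (α * σ) w) v) =
        fun σ : ℝ => (α : ℂ) * ((fun p : ℝ × EuclideanSpace ℝ d => modeDeriv n β α p.1 p.2) ∘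
          (fun σ : ℝ => ((α * σ, v) : ℝ × EuclideanSpace ℝ d))) σ +
          (((α ^ 2 * collisionFrequency β v : ℝ) : ℂ) + ((α * modePhase n v : ℝ) : ℂ) * Complex.I) *
            modeProfile n β α (α * σ) v := by
      funext σ
      simp only [Function.comp_apply, modeDeriv]
      push_cast
      ring
    have hF' : Continuous fun σ : ℝ => ((α ^ 2 : ℝ) : ℂ) * cgain β (fun w => modeProfile n β α (α * σ) w) v := by
      rw [hFe]; exact hF
    exact ((Complex.continuous_exp.comp (by fun_prop)).mul hF').intervalIntegrable _ _
  have hint2 : IntervalIntegrable (fun σ : ℝ => Complex.exp (-z * (τ - σ)) *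
      (((α ^ 2 * a : ℝ) : ℂ) * Complex.exp (-(lam : ℂ) * σ))) volume 0 τ := hcont1.intervalIntegrable _ _
  have hint1 : IntervalIntegrable (fun σ : ℝ => Complex.exp (-z * (τ - σ)) * ((α ^ 2 : ℝ) * X σ)) volume 0 τ := by
    have := hint_total.sub hint2
    refine (this.congr fun σ hσ => ?_)
    rw [uIoc_of_le hτ.1] at hσ
    rw [hFX σ hσ.1.le]
    ring
  have hdec : modeProfile n β α (α * τ) v - (modeMult β b n τ : ℂ) =
      (Complex.exp (-(lam : ℂ) * τ) - Complex.exp (-z * τ)) * ((lam : ℂ) - (α * ω : ℝ) * Complex.I) / (z - lam) +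
        ∫ σ in (0 : ℝ)..τ, Complex.exp (-z * (τ - σ)) * ((α ^ 2 : ℝ) * X σ) := by
    rw [hduh, show -(((α ^ 2 * collisionFrequency β v : ℝ) : ℂ) + ((α * modePhase n v : ℝ) : ℂ) * Complex.I) = -z from rfl,
      intervalIntegral.integral_congr (fun σ hσ => hFX σ (by rw [uIcc_of_le hτ.1] at hσ; exact hσ.1)),
      intervalIntegral.integral_add hint1 hint2,
      integral_exp_duhamel_explicit _ hzl, hmult τ]
    have := explicit_part_algebra (A := α ^ 2 * a) (B := α * ω) (lam := lam) (L := Complex.exp (-(lam : ℂ) * τ))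
      (X := Complex.exp (-z * τ)) hzl
    rw [← hz] at this
    linear_combination this
  -- Step 4: the bounds
  have hex := norm_explicitRelaxation_sub_le (ω := ω) (τ := τ) hlam hav hα0 hbig hτ.1
  have hgain : ‖∫ σ in (0 : ℝ)..τ, Complex.exp (-z * (τ - σ)) * ((α ^ 2 : ℝ) * X σ)‖ ≤ α ^ 2 * Cv / (α ^ 2 * a) := by
    exact norm_integral_duhamel_le (κ := α ^ 2 * a) (θ := α * ω) (α := α) (C := Cv) (by positivity) hτ.1 hXb
  have hnorm : ‖modeProfile n β α (α * τ) v - (modeMult β b n τ : ℂ)‖ ≤ 4 * (lam + α * |ω|) / (α ^ 2 * a) + Cv / a := by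
    rw [hdec]
    refine (norm_add_le _ _).trans (add_le_add ?_ (hgain.trans (le_of_eq (by field_simp))))
    rw [hz]
    exact hex
  -- the explicit term
  have hM1 : maxwellianBeta β v * (4 * (lam + α * |ω|) / (α ^ 2 * a)) ≤ K₁ * α ^ (-(1 : ℝ)) := by
    rw [Real.rpow_neg_one]
    have t1 : 4 * (lam + α * |ω|) / (α ^ 2 * a) ≤ (4 * lam / a₀ + 4 * Cω) * α⁻¹ := by
      rw [div_le_iff₀ (by positivity)]
      have e1 : (4 * lam / a₀ + 4 * Cω) * α⁻¹ * (α ^ 2 * a) = 4 * lam * (α * a / a₀) + 4 * Cω * a * α := by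
        field_simp
      rw [e1]
      have h2 : lam ≤ lam * (α * a / a₀) := by
        have : 1 ≤ α * a / a₀ := by rw [le_div_iff₀ ha₀]; nlinarith only [hα1, ha, ha₀]
        nlinarith only [this, hlam]
      have h3 : α * |ω| ≤ Cω * a * α := by nlinarith only [hω, hα0]
      linarith only [h2, h3]
    calc maxwellianBeta β v * (4 * (lam + α * |ω|) / (α ^ 2 * a)) ≤ M₀ * ((4 * lam / a₀ + 4 * Cω) * α⁻¹) :=
          mul_le_mul hMle t1 (by positivity) hM₀pos.le
      _ ≤ K₁ * α⁻¹ := by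
          rw [hK₁, ← mul_assoc]
          exact mul_le_mul_of_nonneg_right (le_add_of_nonneg_right zero_le_one) (inv_nonneg.2 hα0.le)
  -- the gain term
  have hM2 : maxwellianBeta β v * (Cv / a) ≤ K₂ * α ^ (-(1 / 2 : ℝ)) + K₃ * α ^ (-(θ / 2)) := by
    have hΛα : α ^ (1 / 2 : ℝ) / α = α ^ (-(1 / 2 : ℝ)) := by
      rw [← Real.rpow_sub_one hα0.ne']; norm_num
    have hΛθ : (α ^ (1 / 2 : ℝ)) ^ (-θ) = α ^ (-(θ / 2)) := by
      rw [← Real.rpow_mul hα0.le]; congr 1; ring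
    have hMM : maxwellianBeta β v * maxwellianBeta β v ^ (-θ) = maxwellianBeta β v ^ (1 - θ) := by
      rw [sub_eq_add_neg, Real.rpow_add hMv, Real.rpow_one]
    have hMθ : maxwellianBeta β v ^ (1 - θ) ≤ M₀ ^ (1 - θ) := Real.rpow_le_rpow hMv.le hMle (by linarith only [hθ1])
    have e : maxwellianBeta β v * (Cv / a) =
        (2 * KL) * (maxwellianBeta β v / a) * (α ^ (1 / 2 : ℝ) / α) +
          (6 * Cθ.toReal / a) * (maxwellianBeta β v * maxwellianBeta β v ^ (-θ)) * (α ^ (1 / 2 : ℝ)) ^ (-θ) := by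
      rw [hCv]; field_simp; ring
    rw [e, hΛα, hΛθ, hMM]
    refine add_le_add (mul_le_mul_of_nonneg_right ?_ (Real.rpow_nonneg hα0.le _))
      (mul_le_mul_of_nonneg_right ?_ (Real.rpow_nonneg hα0.le _))
    · rw [hK₂]
      have h1 : maxwellianBeta β v / a ≤ M₀ / a₀ := div_le_div₀ hM₀pos.le hMle ha₀ ha
      have h2 : 2 * KL * (maxwellianBeta β v / a) ≤ 2 * KL * (M₀ / a₀) :=
        mul_le_mul_of_nonneg_left h1 (mul_nonneg two_pos.le hKL0)
      have h3 : 0 ≤ KL * (M₀ / a₀) := mul_nonneg hKL0 (div_nonneg hM₀pos.le ha₀.le)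
      have h4 : 4 * KL * M₀ / a₀ = 4 * (KL * (M₀ / a₀)) := by ring
      linarith only [h2, h3, h4]
    · rw [hK₃]
      have h6 : 6 * Cθ.toReal / a ≤ 6 * Cθ.toReal / a₀ := div_le_div_of_nonneg_left (by positivity) ha₀ ha
      calc 6 * Cθ.toReal / a * maxwellianBeta β v ^ (1 - θ) ≤ 6 * Cθ.toReal / a₀ * M₀ ^ (1 - θ) :=
            mul_le_mul h6 hMθ (Real.rpow_nonneg hMv.le _) (by positivity)
        _ ≤ 6 * Cθ.toReal * M₀ ^ (1 - θ) / a₀ + 1 := by rw [div_mul_eq_mul_div]; linarith only []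
  have s1 : K₁ * α ^ (-(1 : ℝ)) ≤ e / 3 := mul_rpow_neg_le one_pos hK₁pos he3 hαK₁
  have s2 : K₂ * α ^ (-(1 / 2 : ℝ)) ≤ e / 3 := mul_rpow_neg_le (by norm_num) hK₂pos he3 hαK₂
  have s3 : K₃ * α ^ (-(θ / 2)) ≤ e / 3 := mul_rpow_neg_le (by positivity) hK₃pos he3 hαK₃
  have hE' : (Real.exp (-(modeRate β b n * τ)) : ℂ) = (modeMult β b n τ : ℂ) := rfl
  rw [hE']
  calc maxwellianBeta β v * ‖modeProfile n β α (α * τ) v - (modeMult β b n τ : ℂ)‖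
      ≤ maxwellianBeta β v * (4 * (lam + α * |ω|) / (α ^ 2 * a) + Cv / a) := mul_le_mul_of_nonneg_left hnorm hMv.le
    _ = maxwellianBeta β v * (4 * (lam + α * |ω|) / (α ^ 2 * a)) + maxwellianBeta β v * (Cv / a) := by ring
    _ ≤ K₁ * α ^ (-(1 : ℝ)) + (K₂ * α ^ (-(1 / 2 : ℝ)) + K₃ * α ^ (-(θ / 2))) := add_le_add hM1 hM2
    _ ≤ e / 3 + (e / 3 + e / 3) := add_le_add s1 (add_le_add s2 s3)
    _ = e := by ring

/-! ## The discharge of BGSR (6.3) -/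

/-- **BGSR (6.3) for single Fourier modes** (`bgsr_hydrodynamicLimit_mode`, discharged).
[cite: BodineauGallagherSaintRaymondInvent2016, (6.3)] -/
theorem bgsr_hydrodynamicLimit_mode_holds : bgsr_hydrodynamicLimit_mode (d := d) := by
  classical
  exact bgsr_hydrodynamicLimit_mode_of_profile fun hd _ hβ b hb n _ _ hT _ he =>
    modeProfile_relaxation hd hβ b hb n hT he

/-- **BGSR (6.3) for trigonometric-polynomial data** (`bgsr_hydrodynamicLimit_trigPoly`, discharged).
[cite: BodineauGallagherSaintRaymondInvent2016, (6.3) and §6.1.1] -/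
theorem bgsr_hydrodynamicLimit_trigPoly_holds : bgsr_hydrodynamicLimit_trigPoly (d := d) :=
  bgsr_hydrodynamicLimit_trigPoly_of_mode bgsr_hydrodynamicLimit_mode_holds

/-- **BGSR (6.3), the hydrodynamic limit of the linear Boltzmann equation, discharged**:
`sup_{τ ∈ [0,T]} sup_{(x,v)} M_β(v) |φ_α(ατ, x, v) - ρ(τ, x)| → 0` as `α → ∞` for every continuous
probability density `ρ⁰` on `T^d`, `d ≥ 2`, `β > 0` (`bgsr_hydrodynamicLimit` of
`TaggedSphereDiffusion`). Route: reduction to trigonometric polynomials and single Fourier modes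
(`TaggedSphereHydrodynamicReduction`), separation of variables
(`TaggedSphereHydrodynamicModeProfile`), the `L²(M_β)` energy estimate for the Hilbert expansion with
the correctors (6.5), (6.7) and the isotropy (6.8) (`TaggedSphereModeEnergy`, `TaggedSphereSpectralGap`),
and the pointwise step through one Duhamel iteration with the Carleman-kernel moment
(`TaggedSphereCarlemanMoment`, `TaggedSphereGainSplit`, this file).
[cite: BodineauGallagherSaintRaymondInvent2016, (6.3)] -/
theorem bgsr_hydrodynamicLimit_holds : bgsr_hydrodynamicLimit (d := d) :=
  bgsr_hydrodynamicLimit_of_mode bgsr_hydrodynamicLimit_mode_holds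

end

end Literature.MathematicalPhysics.KineticTheory
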